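import Literature.NumberTheory.ComplexMultiplication.ConstantWeightCriterionQuadraticSubfield
import Literature.NumberTheory.ComplexMultiplication.InducedReflex
import HarnessLib

/-!
# A CM field containing an imaginary quadratic field has `v = 1`: `Kᶜ = D·K₀ᶜ`, `Gal(Kᶜ/ℚ) = ⟨ρ⟩ × G₀`
# (Dodson 1984, §3.1.1, first assertion of the Theorem)

B. Dodson, *The structure of Galois groups of CM-fields*, Trans. AMS **283** (1984) [Dodson1984] (held text
`paper:doi-10-2307-1999987`), §3.1.1 Theorem, first assertion, and its proof (p. 12):

> "Suppose the CM-field `K` has an imaginary quadratic subfield, and let `G₀ = Gal(K₀ᶜ/ℚ)` be given by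
> `G₀ ⊂ Sₙ`.  Then `G` as `Gal(Kᶜ/ℚ)` has the trivial `ρ`-structure with `v = 1` on `⟨ρ⟩ × G₀`."  Proof: "Let `D` be
> an imaginary quadratic subfield of `K`.  Then `Kᶜ` is the composite `Kᶜ = DK₀ᶜ`, so that `[Kᶜ : K₀ᶜ] = 2`, i.e.,
> `v = 1`.  But then `K` has two types having `D` as a reflex field of degree `2 = 2ᵛ`, so that `K` determines the
> trivial `ρ`-structure by the corollary of the Reflex Degree Theorem …"

Sequel of `ReflexDegreeImprimitivity.lean` (the pair kernel `V = Gal(Kᶜ/K₀ᶜ) = (ℤ₂)ᵛ`) and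
`ConstantWeightCriterionQuadraticSubfield.lean` (the block `E₀` of an imaginary quadratic subfield — a CM type that
every `g` maps onto `E₀` or `ρE₀`, equivalently a type with reflex degree `2`).  PROVED (theorems only; no
definition, no named fact):

* group level (`IsCMTypeWith ρ E₀`, `hG : ∀ g, gE₀ ∈ {E₀, ρE₀}`, pair kernel `V` characterised by `hV`, faithful
  action): `IsCMTypeWith.eq_one_or_eq_rho_of_mem_pairKernel_of_block` (a pair-preserving `g` is `1` or `ρ`),
  **`….card_pairKernel_eq_two_of_block`** (`|V| = 2`, i.e. `v = 1`), `….stabilizer_sup_pairKernel_eq_top_of_block` and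
  `….isComplement'_stabilizer_pairKernel_of_block` (`G = V · G₀`, `V ∩ G₀ = 1` with `G₀ = Stab(E₀)`: "the trivial
  `ρ`-structure on `⟨ρ⟩ × G₀`");
* number fields (`K` CM, `L = Kᶜ` a normal closure, `K₀ᶜ = normalClosure ℚ K⁺ L`):
  **`finrank_normalClosure_maximalRealSubfield_eq_two_of_finrank_reflexField_eq_two`** — a CM type with reflex degree
  `2` forces `[Kᶜ : K₀ᶜ] = 2`; for an imaginary quadratic field `k₀` (`[k₀ : ℚ] = 2`, totally complex) embedded in `K`
  by `k : k₀ →+* K`, the type of `K` induced from `(k₀, {φ₀})` has reflex field of degree `2`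
  (**`finrank_reflexField_algValuedIn_inducedCMType_single`**, via Streng's "the reflex of the induced type is the
  reflex of the type", `reflexField_preimage_restrictEmb`), hence
  **`finrank_normalClosure_maximalRealSubfield_eq_two_of_ringHom`** ("`[Kᶜ : K₀ᶜ] = 2`, i.e., `v = 1`") and Dodson's
  constant weight criterion with `Φ₀ =` the induced type, **`cmTypeRank_add_eq_of_ringHom`**
  (`Rank(Φ) + [2|Φ₀ ∖ Φ| = [K:ℚ]/2] = r + 1 + [Φ₀ ⊆ Φ]`).

## References

* [Dodson1984] B. Dodson, Trans. AMS 283 (1984), §3.1.1 Theorem (first assertion) and proof, p. 12; §1.1.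
* [Streng2010] M. Streng, *Complex multiplication of abelian surfaces*, Ch. I Lemma 7.3 (reflex of an induced type).
-/

set_option autoImplicit false

open scoped Pointwise

namespace Literature.NumberTheory.ComplexMultiplication

/-! ## Part I — group level -/

section GroupLevel

variable {G : Type*} [Group G] {E : Type*} [MulAction G E] {ρ : G} {E₀ : Set E}

namespace IsCMTypeWith

/-- **`v = 1`**: if a CM type `E₀` is mapped by every `g` onto `E₀` or `ρE₀` (the block of an imaginary quadratic
subfield), then a pair-preserving element (`gx ∈ {x, ρx}` for all `x`) is `1` or `ρ` — it acts on the block as the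
identity or as `ρ`. [cite: Dodson1984, §3.1.1 Theorem (proof)] -/
theorem eq_one_or_eq_rho_of_mem_pairKernel_of_block [FaithfulSMul G E] (h₀ : IsCMTypeWith ρ E₀)
    (hG : ∀ g : G, g • E₀ = E₀ ∨ g • E₀ = ρ • E₀) {V : Subgroup G}
    (hV : ∀ g : G, g ∈ V ↔ ∀ x : E, g • x = x ∨ g • x = ρ • x) {g : G} (hg : g ∈ V) : g = 1 ∨ g = ρ := by
  have hgx := (hV g).1 hg
  rcases hG g with h1 | h1
  · left
    refine eq_of_smul_eq_smul (α := E) fun x => ?_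
    rw [one_smul]
    by_cases hx : x ∈ E₀
    · rcases hgx x with h | h
      · exact h
      · exfalso
        have hmem : g • x ∈ E₀ := by
          rw [← h1]
          exact Set.smul_mem_smul_set hx
        rw [h] at hmem
        exact (h₀.mem_iff x).1 hx hmem
    · rcases hgx x with h | h
      · exact h
      · exfalso
        have hρx : ρ • x ∈ E₀ := (h₀.rho_smul_mem_iff x).2 hx
        have hmem : g • ρ • x ∈ E₀ := by
          rw [← h1]
          exact Set.smul_mem_smul_set hρx
        rw [h₀.comm, h, h₀.invol] at hmem
        exact hx hmem
  · right
    refine eq_of_smul_eq_smul (α := E) fun x => ?_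
    by_cases hx : x ∈ E₀
    · rcases hgx x with h | h
      · exfalso
        have hmem : g • x ∈ ρ • E₀ := by
          rw [← h1]
          exact Set.smul_mem_smul_set hx
        rw [h] at hmem
        obtain ⟨z, hz, hzx⟩ := hmem
        have hzx' : ρ • z = x := hzx
        apply (h₀.mem_iff z).1 hz
        rw [hzx']
        exact hx
      · exact h
    · rcases hgx x with h | h
      · exfalso
        have hρx : ρ • x ∈ E₀ := (h₀.rho_smul_mem_iff x).2 hx
        have hmem : g • ρ • x ∈ ρ • E₀ := by
          rw [← h1]
          exact Set.smul_mem_smul_set hρx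
        rw [h₀.comm, h, Set.smul_mem_smul_set_iff] at hmem
        exact hx hmem
      · exact h

/-- **`|(ℤ₂)ᵛ| = 2`, i.e. `v = 1`** ("`[Kᶜ : K₀ᶜ] = 2`, i.e., `v = 1`"): with such a block the pair kernel is `{1, ρ}`.
[cite: Dodson1984, §3.1.1 Theorem] -/
theorem card_pairKernel_eq_two_of_block [FaithfulSMul G E] [Nonempty E] (h₀ : IsCMTypeWith ρ E₀)
    (hG : ∀ g : G, g • E₀ = E₀ ∨ g • E₀ = ρ • E₀) {V : Subgroup G}
    (hV : ∀ g : G, g ∈ V ↔ ∀ x : E, g • x = x ∨ g • x = ρ • x) : Nat.card V = 2 := by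
  have hρV : ρ ∈ V := rho_mem_of_pairKernel hV
  have hρ1 : (ρ : G) ≠ 1 := fun h1 => by
    obtain ⟨x⟩ := ‹Nonempty E›
    exact h₀.rho_smul_ne x (by rw [h1, one_smul])
  have hset : (V : Set G) = {1, ρ} := by
    ext g
    simp only [SetLike.mem_coe, Set.mem_insert_iff, Set.mem_singleton_iff]
    constructor
    · exact fun hg => h₀.eq_one_or_eq_rho_of_mem_pairKernel_of_block hG hV hg
    · rintro (rfl | rfl)
      exacts [V.one_mem, hρV]
  change Nat.card (V : Set G) = 2
  rw [hset, Nat.card_coe_set_eq, Set.ncard_pair hρ1.symm]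

/-- `Stab(E₀) · (ℤ₂)ᵛ = G` (`G = G₀ ⊔ ρG₀` and `ρ ∈ V`). [cite: Dodson1984, §3.1.1 Theorem (proof)] -/
theorem stabilizer_sup_pairKernel_eq_top_of_block (h₀ : IsCMTypeWith ρ E₀)
    (hG : ∀ g : G, g • E₀ = E₀ ∨ g • E₀ = ρ • E₀) {V : Subgroup G}
    (hV : ∀ g : G, g ∈ V ↔ ∀ x : E, g • x = x ∨ g • x = ρ • x) : MulAction.stabilizer G E₀ ⊔ V = ⊤ := by
  rw [eq_top_iff]
  intro g _
  rcases h₀.mem_stabilizer_or hG g with hg | hg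
  · exact Subgroup.mem_sup_left hg
  · have : g = ρ⁻¹ * (ρ * g) := by group
    rw [this]
    exact Subgroup.mul_mem _ (Subgroup.mem_sup_right (V.inv_mem (rho_mem_of_pairKernel hV)))
      (Subgroup.mem_sup_left hg)

/-- **"The trivial `ρ`-structure with `v = 1` on `⟨ρ⟩ × G₀`"**: `G₀ = Stab(E₀)` is a complement of the pair kernel
`V = {1, ρ}` (so `G = V × G₀`, `V` being central). [cite: Dodson1984, §3.1.1 Theorem] -/
theorem isComplement'_stabilizer_pairKernel_of_block [FaithfulSMul G E] [Finite G] (h₀ : IsCMTypeWith ρ E₀)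
    (hG : ∀ g : G, g • E₀ = E₀ ∨ g • E₀ = ρ • E₀) {V : Subgroup G}
    (hV : ∀ g : G, g ∈ V ↔ ∀ x : E, g • x = x ∨ g • x = ρ • x) :
    (MulAction.stabilizer G E₀).IsComplement' V :=
  (h₀.isComplement'_stabilizer_pairKernel_iff hV).2
    ((h₀.card_orbit_eq_card_pairKernel_iff hV).2 (h₀.stabilizer_sup_pairKernel_eq_top_of_block hG hV))

/-- The orbit of the block has `|V| = 2` elements (the "two types having `D` as a reflex field of degree `2 = 2ᵛ`").
[cite: Dodson1984, §3.1.1 Theorem (proof)] -/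
theorem card_orbit_eq_two_of_block [FaithfulSMul G E] [Finite G] [Nonempty E] (h₀ : IsCMTypeWith ρ E₀)
    (hG : ∀ g : G, g • E₀ = E₀ ∨ g • E₀ = ρ • E₀) {V : Subgroup G}
    (hV : ∀ g : G, g ∈ V ↔ ∀ x : E, g • x = x ∨ g • x = ρ • x) : Nat.card (MulAction.orbit G E₀) = 2 := by
  rw [(h₀.card_orbit_eq_card_pairKernel_iff hV).2 (h₀.stabilizer_sup_pairKernel_eq_top_of_block hG hV),
    h₀.card_pairKernel_eq_two_of_block hG hV]

end IsCMTypeWith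

end GroupLevel

/-! ## Part II — number fields -/

section NumberField

open NumberField IntermediateField
open Literature.AlgebraicGeometry.Motives (CMType)
open Literature.AlgebraicGeometry.Pohlmann1968 (cmTypeRank)

variable {K : Type} [Field K] [NumberField K] [IsCMField K]
variable {L : Type} [Field L] [NumberField L] [IsCMField L]

/-- **A CM type with reflex degree `2` forces `v = 1`: `[Kᶜ : K₀ᶜ] = 2`** ("`K` has two types having `D` as a reflex
field of degree `2 = 2ᵛ`"). [cite: Dodson1984, §3.1.1 Theorem (proof)] -/
theorem finrank_normalClosure_maximalRealSubfield_eq_two_of_finrank_reflexField_eq_two [IsNormalClosure ℚ K L]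
    (j : K →ₐ[ℚ] L) {Ψ₀ : Set (K →ₐ[ℚ] L)} (hΨ₀ : IsCMTypeWith (conjGal : L ≃ₐ[ℚ] L) Ψ₀)
    (h2 : Module.finrank ℚ (reflexField ℚ L Ψ₀) = 2) :
    Module.finrank (normalClosure ℚ (maximalRealSubfield K) L) L = 2 := by
  haveI : Normal ℚ L := IsNormalClosure.normal (F := ℚ) (K := K) (L := L)
  haveI : IsGalois ℚ L := isGalois_of_isNormalClosure (L := L) K
  haveI : Nonempty (K →ₐ[ℚ] L) := ⟨j⟩
  have hV := mem_fixingSubgroup_normalClosure_maximalRealSubfield_iff (K := K) (L := L) j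
  have horb : (MulAction.orbit (L ≃ₐ[ℚ] L) Ψ₀).ncard = 2 := by
    rw [← Nat.card_coe_set_eq, ← finrank_reflexField_eq_card_orbit, h2]
  have hG := hΨ₀.smul_eq_or_of_ncard_orbit_eq_two horb
  rw [← IsGalois.card_fixingSubgroup_eq_finrank]
  exact hΨ₀.card_pairKernel_eq_two_of_block hG hV

/-- … and `Gal(Kᶜ/K′) · Gal(Kᶜ/K₀ᶜ) = Gal(Kᶜ/ℚ)` with trivial intersection: `Gal(Kᶜ/ℚ) = ⟨ρ⟩ × Gal(Kᶜ/K′)` for the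
quadratic reflex field `K′` ("the trivial `ρ`-structure with `v = 1` on `⟨ρ⟩ × G₀`").
[cite: Dodson1984, §3.1.1 Theorem] -/
theorem isComplement'_fixingSubgroup_reflexField_of_finrank_eq_two [IsNormalClosure ℚ K L] (j : K →ₐ[ℚ] L)
    {Ψ₀ : Set (K →ₐ[ℚ] L)} (hΨ₀ : IsCMTypeWith (conjGal : L ≃ₐ[ℚ] L) Ψ₀)
    (h2 : Module.finrank ℚ (reflexField ℚ L Ψ₀) = 2) :
    (reflexField ℚ L Ψ₀).fixingSubgroup.IsComplement' (normalClosure ℚ (maximalRealSubfield K) L).fixingSubgroup :=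
  (finrank_reflexField_eq_iff_isComplement' j hΨ₀).1
    (h2.trans (finrank_normalClosure_maximalRealSubfield_eq_two_of_finrank_reflexField_eq_two j hΨ₀ h2).symm)

section ImaginaryQuadratic

variable {k₀ : Type} [Field k₀] [NumberField k₀] [IsTotallyComplex k₀]

omit [IsCMField K] [IsCMField L] [IsTotallyComplex k₀] in
/-- Reading an induced complex CM type in `Hom_ℚ(K, L)` is inducing the read type along restriction of
embeddings. [folklore] -/
private theorem algValuedIn_inducedCMType_eq_preimage (k : k₀ →+* K) (ι : L →+* ℂ) (Ψ : CMType k₀) :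
    algValuedIn ι (inducedCMType k Ψ).1 = (restrictEmb (Ω := L) k.toRatAlgHom) ⁻¹' (algValuedIn ι Ψ.1) := by
  ext χ
  rw [mem_algValuedIn_iff, mem_inducedCMType_iff, Set.mem_preimage, restrictEmb_apply, mem_algValuedIn_iff]
  constructor <;> intro h <;> convert h using 2 <;> ext x <;> simp

omit [IsCMField K] [IsCMField L] in
/-- **The type of `K` induced from an imaginary quadratic field has reflex degree `2`** (its reflex field is the
image of `k₀`: "`K` has two types having `D` as a reflex field of degree `2`"; the reflex of the induced type is the
reflex of the type, Streng Lemma 7.3). [cite: Dodson1984, §3.1.1 Theorem (proof)] -/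
theorem finrank_reflexField_algValuedIn_inducedCMType_single [Normal ℚ L] (h2 : Module.finrank ℚ k₀ = 2)
    (k : k₀ →+* K) (j : K →ₐ[ℚ] L) (ι : L →+* ℂ) (φ₀ : k₀ →+* ℂ) :
    Module.finrank ℚ (reflexField ℚ L (algValuedIn ι (inducedCMType k (CMTypeCount.single h2 φ₀)).1)) = 2 := by
  haveI : IsGalois ℚ L := ⟨⟩
  rw [algValuedIn_inducedCMType_eq_preimage, reflexField_preimage_restrictEmb k.toRatAlgHom j,
    CMTypeCount.single_val]
  -- the embedding `e₀ : k₀ → L` under `φ₀`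
  obtain ⟨e₀, he₀⟩ := (algHomEquivRingHomOfNormal (j.comp k.toRatAlgHom) ι).surjective φ₀
  rw [algHomEquivRingHomOfNormal_apply] at he₀
  have hset : algValuedIn ι ({φ₀} : Set (k₀ →+* ℂ)) = {e₀} := by
    ext χ
    rw [mem_algValuedIn_iff, Set.mem_singleton_iff, Set.mem_singleton_iff, ← he₀]
    exact ⟨fun h => comp_algHom_injective ι h, fun h => by rw [h]⟩
  rw [hset, reflexField_eq_fixedField, MulAction.stabilizer_singleton, stabilizer_algHom_eq_fixingSubgroup,
    IsGalois.fixedField_fixingSubgroup, ← IntermediateField.finrank_eq_finrank_subalgebra,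
    AlgHom.fieldRange_toSubalgebra, ← h2]
  exact (AlgEquiv.ofInjectiveField e₀).toLinearEquiv.finrank_eq.symm

/-- **Dodson §3.1.1, first assertion: "`Kᶜ = DK₀ᶜ`, so that `[Kᶜ : K₀ᶜ] = 2`, i.e., `v = 1`"** — for a CM field `K`
receiving an imaginary quadratic field `k₀` (`[k₀ : ℚ] = 2`, totally complex) by `k : k₀ →+* K`, and `L = Kᶜ` a
normal closure. [cite: Dodson1984, §3.1.1 Theorem] -/
theorem finrank_normalClosure_maximalRealSubfield_eq_two_of_ringHom [IsNormalClosure ℚ K L]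
    (h2 : Module.finrank ℚ k₀ = 2) (k : k₀ →+* K) (j : K →ₐ[ℚ] L) :
    Module.finrank (normalClosure ℚ (maximalRealSubfield K) L) L = 2 := by
  haveI : Normal ℚ L := IsNormalClosure.normal (F := ℚ) (K := K) (L := L)
  obtain ⟨ι⟩ : Nonempty (L →+* ℂ) := inferInstance
  obtain ⟨φ₀⟩ : Nonempty (k₀ →+* ℂ) := inferInstance
  exact finrank_normalClosure_maximalRealSubfield_eq_two_of_finrank_reflexField_eq_two j
    (isCMTypeWith_conjGal_algValuedIn ι (inducedCMType k (CMTypeCount.single h2 φ₀)))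
    (finrank_reflexField_algValuedIn_inducedCMType_single h2 k j ι φ₀)

/-- **`Gal(Kᶜ/ℚ) = ⟨ρ⟩ × G₀`**: the stabiliser of the induced type, `Gal(Kᶜ/D)`, is a complement of
`Gal(Kᶜ/K₀ᶜ) = {1, ρ}`. [cite: Dodson1984, §3.1.1 Theorem] -/
theorem isComplement'_fixingSubgroup_reflexField_inducedCMType [IsNormalClosure ℚ K L]
    (h2 : Module.finrank ℚ k₀ = 2) (k : k₀ →+* K) (j : K →ₐ[ℚ] L) (ι : L →+* ℂ) (φ₀ : k₀ →+* ℂ) :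
    (reflexField ℚ L (algValuedIn ι (inducedCMType k (CMTypeCount.single h2 φ₀)).1)).fixingSubgroup.IsComplement'
      (normalClosure ℚ (maximalRealSubfield K) L).fixingSubgroup := by
  haveI : Normal ℚ L := IsNormalClosure.normal (F := ℚ) (K := K) (L := L)
  exact isComplement'_fixingSubgroup_reflexField_of_finrank_eq_two j
    (isCMTypeWith_conjGal_algValuedIn ι (inducedCMType k (CMTypeCount.single h2 φ₀)))
    (finrank_reflexField_algValuedIn_inducedCMType_single h2 k j ι φ₀)

omit [IsCMField K] in
/-- **Dodson's constant weight criterion for a CM field containing an imaginary quadratic field `k₀`**, with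
`Φ₀ = ` the type induced from `(k₀, {φ₀})` ("the trivial `ρ`-structure", `f = Φ₀ ∖ Φ`):
`Rank(Φ) + [2|Φ₀ ∖ Φ| = [K:ℚ]/2] = r + 1 + [Φ₀ ⊆ Φ]`, `r` the rank of the `Gal(L/D)`-translates of `f` in any Galois CM
field `L ⊇ K`. [cite: Dodson1984, §3.1.1 Theorem] -/
theorem cmTypeRank_add_eq_of_ringHom [IsGalois ℚ L] (h2 : Module.finrank ℚ k₀ = 2) (k : k₀ →+* K)
    (j : K →ₐ[ℚ] L) (ι : L →+* ℂ) (φ₀ : k₀ →+* ℂ) (Φ : CMType K)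
    [Decidable ((inducedCMType k (CMTypeCount.single h2 φ₀)).1 ⊆ Φ.1)] :
    cmTypeRank Φ +
        (if 2 * ((inducedCMType k (CMTypeCount.single h2 φ₀)).1 \ Φ.1).ncard = Module.finrank ℚ K / 2
          then 1 else 0) =
      typeRank (MulAction.stabilizer (L ≃ₐ[ℚ] L) (algValuedIn ι (inducedCMType k (CMTypeCount.single h2 φ₀)).1))
          (algValuedIn ι (inducedCMType k (CMTypeCount.single h2 φ₀)).1 \ algValuedIn ι Φ.1) + 1 +
        (if (inducedCMType k (CMTypeCount.single h2 φ₀)).1 ⊆ Φ.1 then 1 else 0) :=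
  cmTypeRank_add_eq_typeRank_stabilizer_add j ι _ Φ (finrank_reflexField_algValuedIn_inducedCMType_single h2 k j ι φ₀)

end ImaginaryQuadratic

end NumberField

end Literature.NumberTheory.ComplexMultiplication
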